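import Summits.CriticalPhenomena.PercolationContinuityZ3.Theorems.Transplant.SkelSign2ParamsAtQ
import Summits.CriticalPhenomena.PercolationContinuityZ3.Theorems.Transplant.SkelPhiConcAssemblyG
import HarnessLib

/-!
# D″ L7′ params, part 7: UNPACKING `signChoice₂` AT THE RUNNING DENSITY, II — the ACCURACIES by name (`δkit ≤ δ, δ₂, δr n, δUP n (δ₂²)`,
# `δI ≤ δkit²`, `η = δkit/2`), the ∀-length INNER CHAIN PROPERTY at accuracy `δkit` delivering `1 − δ₂²` (every `n ≤ 40A + 1000`), the COUNTS at
# `q ∈ [p/2, p]` (`hk : (1 − q^{sB})^k ≤ δkit`, `hN : k·B ≤ N`, `hcount : 1/(1−q)^{Δ N} ≤ δkit · Lcnt`), the Step-I′ INPUTS at any coarser threshold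
# (`1 − a` for `a ≥ δI`; `1 − a²` for `a ≥ δkit` — the `h` of `kitClause_stepI`), the EXCESS RADIUS at `q` (`hRex`/`hR₁` of the three residues, every
# centre, planar diameter `≤ 60 rmax`), and the SCHEDULE by name (`Λ O q = concRadii2S cells gap 0 E₀ L′` + the fibre facts of `SkelPhiParamsSched`
# instantiated: `hgap_face hgapL 20rmax≤gap 44rmax+4≤E₀ hsch hRt WFS2`) — twin of SkelConcParamsAtQ §AtQ/§Sched (p238500)

builds on p205010 (kernel theorem, internal audit signed; external expert review pending) — nothing in this file uses p205010.
Status sentence (coordinator 2026-08-20T04:30Z): "θ(p_c) = 0 on ℤ^d, all d ≥ 2 — kernel-verified (Lean 4/Mathlib, standard axioms); internal adversarial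
audit SIGNED 2026-08-20 04:29Z; external expert review pending."
Lane `prim-bschramm-*`, seat `prim-bschramm-stmt` (gen 9); helper file (`--supports stmt-CriticalPhenomena-4575`).  Ledger SIGN-PARAMS.md §1S/1I/§5.
[cite: KozmaNitzan2024, §4 Theorem 6 (pp. 25–31); Lemma 10 Steps II–III (pp. 18–19); Lemma 12 (p. 24)]
-/

noncomputable section

open MeasureTheory
open scoped Classical

namespace Summit.CriticalPhenomena.PercolationContinuityZ3.Theorems.Transplant

namespace PlanarSkeletonSign

namespace Sgn₂

open Literature.Probability.Percolation Literature.Probability.LatticeModels SimpleGraph KNLevels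
open Literature.Barriers.CriticalPhenomena (graphBall)
open SkelConc (Consts)
open Sgn (K a A L twenty_le_K one_le_a hundred_le_A K_le_A five_le_L sixteen_L_le_A δkit δI m₀ Mu ρz M T₀ Kd Rseed rs cU sB B kP NP Lcnt Rlev R' η reachK Sz L_hyps)
open BoxProdZ2 (ConcRadiiG Kof Erad Frad kitK kitN kitL kit_counts_at kit_counts_at_le kitK_mul_le_kitN kitL_pos)
open Skel (excess)

/-! ## §1 The accuracies by name (p-level: no `AtQ` needed) -/

section Acc

variable (κ : Consts) {V : Type} [DecidableEq V] [Countable V] {G : SimpleGraph V} [G.LocallyFinite] (Φ : PlanarSkeletonSign G)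

/-- **`δkit`**: positive, `≤ 1`, below `δ`, `δ₂`, every root accuracy `δr n` and every inner-chain accuracy `δUP n (δ₂²)` for `n ≤ 40A + 1000`. [folklore] -/
theorem δkit_facts : 0 < δkit κ Φ ∧ δkit κ Φ ≤ 1 ∧ δkit κ Φ ≤ κ.δ ∧ δkit κ Φ ≤ κ.δ₂ ∧
    (∀ n, n ≤ Skelφ.Prm.nmax (A κ) → δkit κ Φ ≤ κ.δr n) ∧
    (∀ n, n ≤ Skelφ.Prm.nmax (A κ) → δkit κ Φ ≤ Skelφ.δUP G Φ.degree_le n (κ.δ₂ ^ 2)) :=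
  ⟨Skelφ.Prm.δkit_pos G Φ.degree_le κ _, Skelφ.Prm.δkit_le_one G Φ.degree_le κ _, Skelφ.Prm.δkit_le_δ G Φ.degree_le κ _,
    Skelφ.Prm.δkit_le_δ₂ G Φ.degree_le κ _, fun _ hn => Skelφ.Prm.δkit_le_δr G Φ.degree_le κ _ hn,
    fun _ hn => Skelφ.Prm.δkit_le_δUP G Φ.degree_le κ _ hn⟩

/-- **`δI`**: positive and `≤ δkit²` (indeed `= (δkit/4)²`). [folklore] -/
theorem δI_facts : 0 < δI κ Φ ∧ δI κ Φ ≤ δkit κ Φ ^ 2 ∧ δI κ Φ = (δkit κ Φ / 4) ^ 2 :=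
  ⟨Skelφ.Prm.δI_pos G Φ.degree_le κ _, Skelφ.Prm.δI_le_sq G Φ.degree_le κ _, Skelφ.Prm.δI_eq G Φ.degree_le κ _⟩

/-- **`η = δkit/2`**: positive, `≤ δ/2`, `≤ δ₂/2` (the excess tolerances `hη : η ≤ δc/2` of the face / corridor / root steps). [folklore] -/
theorem η_facts : 0 < η κ Φ ∧ η κ Φ = δkit κ Φ / 2 ∧ η κ Φ ≤ κ.δ / 2 ∧ η κ Φ ≤ κ.δ₂ / 2 := by
  have h := δkit_facts κ Φ
  refine ⟨by unfold η; linarith [h.1], rfl, by unfold η; linarith [h.2.2.1], by unfold η; linarith [h.2.2.2.1]⟩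

/-- **The inner chain property of EVERY length `n ≤ 40A + 1000` with kits at accuracy `δkit`, delivering `1 − δ₂²`**, in every subgraph
`G' ≤ G`, at every `q < 1` ((F)'s `hchain` for the inner band runs; `δAcc_spec` + monotonicity). [cite: KozmaNitzan2024, §4 Lemma 11 (p. 22)] -/
theorem inner_chain (n : ℕ) (hn : n ≤ Skelφ.Prm.nmax (A κ)) {q : unitInterval} (hq1 : (q : ℝ) < 1)
    (G' : SimpleGraph V) [G'.LocallyFinite] (hG' : G' ≤ G) :
    ∀ (Wt : Sym2 V → unitInterval) (s : Fin (n + 1) → TStep G') (T' : Fin (n + 1) → Finset V) (η' : ℝ),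
      (∀ i : Fin (n + 1), (s i).L.o = (s 0).L.o) →
      (∀ i : Fin n, T' (Fin.castSucc i) ⊆ (s i.succ).L.X 0) →
      (∀ i : Fin (n + 1), T' i ⊆ (s i).T) →
      (∀ i : Fin (n + 1), (s i).KitsAt Wt q Φ.Δ (δkit κ Φ)) →
      η' ≤ δkit κ Φ / 2 →
      (∀ i : Fin (n + 1), (prodBernoulli Wt).real (⋃ t ∈ (s i).T \ T' i, openConn (s 0).L.o t) ≤ η') →
      1 - δkit κ Φ < (prodBernoulli Wt).real (s 0).L.reachB →
        1 - κ.δ₂ ^ 2 < (prodBernoulli Wt).real (⋃ t ∈ T' (Fin.last n), openConn (s 0).L.o t) := by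
  intro Wt s T' η' ho hlink hsub hkits hη hexc hsrc
  have hle : δkit κ Φ ≤ Skelφ.Prm.δAcc G Φ.degree_le (Skelφ.Prm.nmax (A κ)) (κ.δ₂ ^ 2) := Skelφ.Prm.δkit_le_δAcc G Φ.degree_le κ _
  exact Skelφ.Prm.δAcc_spec G Φ.degree_le _ (pow_pos κ.hδ₂0 2) hn hq1 G' hG' Wt s T' η' ho hlink hsub (fun i => (hkits i).mono hle)
    (hη.trans (by linarith)) hexc (by linarith)

end Acc

section AtQ

variable {κ : Consts} {V : Type} [DecidableEq V] [Countable V] {G : SimpleGraph V} [G.LocallyFinite] {Φ : PlanarSkeletonSign G}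
  {t : V} {p : unitInterval} {hC : Φ.CylSubcritical p} {O : Skelφ.StepI.Out V} {q : unitInterval}
  (hat : (choiceAt κ Φ t p hC).AtQ O q)
include hat

/-! ## §2 The counts at the running density -/

/-- **`hk`, `hcount` at `q`**: `(1 − q^{sB})^k ≤ δkit` and `1/(1−q)^{Δ·N} ≤ δkit · L'` for every `L' ≥ Lcnt` (counts fixed at `p`, valid on `[p/2, p]`).
[cite: KozmaNitzan2024, §4 Lemma 10 Steps II–III (pp. 18–19)] -/
theorem counts_at (hp0 : 0 < (p : ℝ)) (hp1 : (p : ℝ) < 1) :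
    (1 - (q : ℝ) ^ sB Φ O) ^ kP κ Φ p O ≤ δkit κ Φ ∧
      ∀ L', Lcnt κ Φ p O ≤ L' → 1 / (1 - (q : ℝ)) ^ (Φ.Δ * NP κ Φ p O) ≤ δkit κ Φ * (L' : ℝ) :=
  kit_counts_at Φ.Δ (sB Φ O) (B Φ O) (δkit_facts κ Φ).1 p hp0 hp1 (hq1_at hat) (hq2_at hat)

/-- The counts at a COARSER accuracy `a ≥ δkit` (one triple serves every residue). [folklore] -/
theorem counts_at_le (hp0 : 0 < (p : ℝ)) (hp1 : (p : ℝ) < 1) {a : ℝ} (ha : δkit κ Φ ≤ a) :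
    (1 - (q : ℝ) ^ sB Φ O) ^ kP κ Φ p O ≤ a ∧
      ∀ L', Lcnt κ Φ p O ≤ L' → 1 / (1 - (q : ℝ)) ^ (Φ.Δ * NP κ Φ p O) ≤ a * (L' : ℝ) :=
  kit_counts_at_le Φ.Δ (sB Φ O) (B Φ O) (δkit_facts κ Φ).1 ha p hp0 hp1 (hq1_at hat) (hq2_at hat)

omit hat in
/-- **`hN : k·B ≤ N`** and `0 < Lcnt`. [folklore] -/
theorem hN (hp0 : 0 < (p : ℝ)) (hp1 : (p : ℝ) < 1) : kP κ Φ p O * B Φ O ≤ NP κ Φ p O ∧ 0 < Lcnt κ Φ p O :=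
  ⟨kitK_mul_le_kitN Φ.Δ (sB Φ O) (B Φ O) (δkit_facts κ Φ).1 p hp0 hp1, kitL_pos Φ.Δ (sB Φ O) (B Φ O) (δkit_facts κ Φ).1 p hp0 hp1⟩

omit hat in
/-- The window has at least `Lcnt` levels: `card (Icc T₀ (T₀ + Lcnt − 1)) = Lcnt` when `0 < Lcnt`; and `T₀ + Lcnt − 1 ≤ Rlev`. [folklore] -/
theorem levels_card (hp0 : 0 < (p : ℝ)) (hp1 : (p : ℝ) < 1) :
    (Finset.Icc (T₀ O) (T₀ O + Lcnt κ Φ p O - 1)).card = Lcnt κ Φ p O ∧ T₀ O + Lcnt κ Φ p O - 1 ≤ Rlev κ Φ p O := by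
  have hL := (hN (κ := κ) (Φ := Φ) (p := p) (O := O) hp0 hp1).2
  refine ⟨?_, ?_⟩
  · rw [Nat.card_Icc]; omega
  · unfold Rlev; omega

/-! ## §3 The Step-I′ inputs at coarser thresholds -/

/-- **Inputs at `1 − a` for every `a ≥ δI`.** [folklore] -/
theorem inputs_at_le {a : ℝ} (ha : δI κ Φ ≤ a) : ∀ i ∈ Skelφ.StepI.index {t} (Sz O) (Sx κ Φ p O) (Sy κ Φ p O),
    1 - a < (bondPercolation G q).real (Skelφ.StepI.event G Φ.φ O.D i) :=
  fun i hi => Skelφ.Prm.inputs_mono ha (inputs_at hat i hi)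

/-- **Inputs at `1 − a²` for every `a ≥ δkit`** — the `h` of `Skelφ.kitClause_stepI` / `kitCon_stepI` with kit accuracy `a ∈ {δkit, κ.δ₂, κ.δ, …}`.
[folklore] -/
theorem inputs_at_sq {a : ℝ} (ha : δkit κ Φ ≤ a) : ∀ i ∈ Skelφ.StepI.index {t} (Sz O) (Sx κ Φ p O) (Sy κ Φ p O),
    1 - a ^ 2 < (bondPercolation G q).real (Skelφ.StepI.event G Φ.φ O.D i) :=
  inputs_at_le hat (Skelφ.Prm.δI_le_sq_of_le G Φ.degree_le κ _ ha)

/-! ## §4 The excess radius at the running density -/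

/-- **`hRex` at `q`, every centre**: beyond `Rex q ρ`, every habitat `D ⊆ B_G(c, Rw)` of planar diameter `≤ 60 rmax` with entrances `A' ⊆ D` at depth
`≤ ρ` from `c` has `P_q(excess c R D A') ≤ η` (`Skelφ.excessRadiusAtK_spec` under Φ2 at `q`). [cite: KozmaNitzan2024, §4 Lemma 12 (p. 24)] -/
theorem hRex_at (ρ : ℕ) : ∀ (c : V) (R : ℕ), Rex κ Φ p O q ρ ≤ R → ∀ (Rw : ℕ) (D A' : Finset V), (∀ d ∈ D, d ∈ graphBall G c Rw) →
      (∀ d ∈ D, ∀ d' ∈ D, Φ.φ d - Φ.φ d' ∈ box 2 (60 * (cells κ Φ p O).rmax)) → A' ⊆ D → (∀ a ∈ A', a ∈ graphBall G c ρ) →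
        (bondPercolation G q).real (excess G c R D A') ≤ η κ Φ :=
  Skelφ.excessRadiusAtK_spec Φ.frame Φ.degree_le _ (η_facts κ Φ).1 (cyl_at' hat) ρ

/-- `hRex` at `q` for any planar diameter `m ≤ 60 rmax` and any tolerance `η' ≥ η`. [folklore] -/
theorem hRex_at_le (ρ : ℕ) {m : ℕ} (hm : m ≤ 60 * (cells κ Φ p O).rmax) {η' : ℝ} (hη' : η κ Φ ≤ η') :
    ∀ (c : V) (R : ℕ), Rex κ Φ p O q ρ ≤ R → ∀ (Rw : ℕ) (D A' : Finset V), (∀ d ∈ D, d ∈ graphBall G c Rw) →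
      (∀ d ∈ D, ∀ d' ∈ D, Φ.φ d - Φ.φ d' ∈ box 2 m) → A' ⊆ D → (∀ a ∈ A', a ∈ graphBall G c ρ) →
        (bondPercolation G q).real (excess G c R D A') ≤ η' :=
  fun c R hR Rw D A' hD hm' hAD hA => (hRex_at hat ρ c R hR Rw D A' hD (fun d hd d' hd' => box_mono 2 hm (hm' d hd d' hd')) hAD hA).trans hη'

/-! ## §5 The schedule and the scheme by name -/

omit hat in
/-- The bundle's projections: `P O = cells`, `Λ O q = Sgn.Λ`, `δI`, `m₀`, the lists. [folklore] -/
theorem choiceAt_proj : (choiceAt κ Φ t p hC).P O = cells κ Φ p O ∧ (choiceAt κ Φ t p hC).Λ O q = Λ κ Φ p O q ∧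
    (choiceAt κ Φ t p hC).δI = δI κ Φ ∧ (choiceAt κ Φ t p hC).m₀ = m₀ κ ∧ (choiceAt κ Φ t p hC).Sz O = Sz O ∧
    (choiceAt κ Φ t p hC).Sx O = Sx κ Φ p O ∧ (choiceAt κ Φ t p hC).Sy O = Sy κ Φ p O :=
  ⟨rfl, rfl, rfl, rfl, rfl, rfl, rfl⟩

omit hat in
/-- **The scheme and the faces of the choices** are the scheme of record over the two-unit cells: `⟨cellGeomSG G Φ.φ cells t (Λ O q), q, κ.δ⟩ =
Skelφ.concSchemeSG …` and `faceDataSG`. [folklore] -/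
theorem scheme_eq : (choiceAt κ Φ t p hC).scheme O q = Skelφ.concSchemeSG G Φ.φ (cells κ Φ p O) t (Λ κ Φ p O q) q κ.δ ∧
    (choiceAt κ Φ t p hC).faces O q = Skelφ.faceDataSG G Φ.φ (cells κ Φ p O) t (Λ κ Φ p O q) := ⟨rfl, rfl⟩

omit hat in
/-- **The schedule by name**: `Λ O q = concRadii2S cells (gap) 0 (E₀) (L′)` with the fibre block `Skelφ.Prm.*` of `schedIn O q`. [folklore] -/
theorem Λ_eq : Λ κ Φ p O q = Skelφ.concRadii2S (cells κ Φ p O) (Skelφ.Prm.gap (schedIn κ Φ p O q)) (fun _ => 0)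
    (Skelφ.Prm.E₀ (schedIn κ Φ p O q)) (Skelφ.Prm.Lp (schedIn κ Φ p O q)) := rfl

omit hat in
/-- The fibre-block inputs by name. [folklore] -/
theorem schedIn_proj : (schedIn κ Φ p O q).rmax = (cells κ Φ p O).rmax ∧ (schedIn κ Φ p O q).u = topScale κ Φ p O ∧
    (schedIn κ Φ p O q).M = M O ∧ (schedIn κ Φ p O q).ψM = ψMz O ∧ (schedIn κ Φ p O q).ψtop = O.D.R (topScale κ Φ p O) ∧
    (schedIn κ Φ p O q).reachK = reachK Φ O ∧ (schedIn κ Φ p O q).Rex = Rex κ Φ p O q := ⟨rfl, rfl, rfl, rfl, rfl, rfl, rfl⟩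

omit [DecidableEq V] [Countable V] hat in
/-- The seed-depth slot dominates both the kit fat radius and the wired seed's depth: `ψ M ≤ ψMz`, `ρz = ψ Mu + off ≤ ψMz`. [folklore] -/
theorem ψMz_ge : O.D.R (M O) ≤ ψMz O ∧ ρz O ≤ ψMz O ∧ O.D.R (Mu O) + O.off ≤ ψMz O := ⟨le_max_left _ _, le_max_right _ _, le_max_right _ _⟩

omit hat in
/-- **The inner excess radius fits in `L_A`**: `Rex q (2·ψMz) ≤ L_A` (entrances as deep as the wired seed, `ρz ≤ 2ψMz`). [folklore] -/
theorem Rex_seed_le_LA : Rex κ Φ p O q (2 * ψMz O) ≤ Skelφ.Prm.LA (schedIn κ Φ p O q) ∧ ρz O ≤ 2 * ψMz O :=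
  ⟨Skelφ.Prm.Rex_le_LA (schedIn κ Φ p O q), by have := (ψMz_ge (O := O)).2.1; omega⟩

omit hat in
/-- **`WFS2 cells (Λ O q)`** (the `WFHolds` half). [folklore] -/
theorem WFS2_at : Skelφ.WFS2 (cells κ Φ p O) (Λ κ Φ p O q) := Skelφ.Prm.sched_WFS2 (schedIn κ Φ p O q) _

omit hat in
/-- **The fibre facts at `(O, q)`**: `hgap_face`, `hgapL`, `20 rmax ≤ gap`, `1 ≤ gap`, `hsch`, `hRt` (SkelPhiParamsSched instantiated). [folklore] -/
theorem fibre_at (ρ g : ℕ) :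
    2 * Skelφ.Prm.Lp (schedIn κ Φ p O q) + Rex κ Φ p O q (ρ + 1) + 100 * (cells κ Φ p O).rmax ≤ Skelφ.Prm.gap (schedIn κ Φ p O q) ρ ∧
    Skelφ.Prm.Lp (schedIn κ Φ p O q) ≤ Skelφ.Prm.gap (schedIn κ Φ p O q) ρ ∧
    20 * (cells κ Φ p O).rmax ≤ Skelφ.Prm.gap (schedIn κ Φ p O q) ρ ∧ 1 ≤ Skelφ.Prm.gap (schedIn κ Φ p O q) ρ ∧
    Rex κ Φ p O q (Erad (Skelφ.Prm.gap (schedIn κ Φ p O q)) (fun _ => 0) (Skelφ.Prm.E₀ (schedIn κ Φ p O q)) g + 1) +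
        100 * (cells κ Φ p O).rmax + Skelφ.Prm.Lp (schedIn κ Φ p O q) ≤
      Erad (Skelφ.Prm.gap (schedIn κ Φ p O q)) (fun _ => 0) (Skelφ.Prm.E₀ (schedIn κ Φ p O q)) (g + 1) ∧
    Frad (Skelφ.Prm.gap (schedIn κ Φ p O q)) (fun _ => 0) (Skelφ.Prm.E₀ (schedIn κ Φ p O q)) 1 - Skelφ.Prm.Lp (schedIn κ Φ p O q) =
      Skelφ.Prm.E₀ (schedIn κ Φ p O q) + Skelφ.Prm.Lp (schedIn κ Φ p O q) + 1 + Rex κ Φ p O q (Skelφ.Prm.E₀ (schedIn κ Φ p O q) + 1) +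
        100 * (cells κ Φ p O).rmax :=
  ⟨Skelφ.Prm.hgap_face (schedIn κ Φ p O q) ρ, Skelφ.Prm.hgapL (schedIn κ Φ p O q) ρ, Skelφ.Prm.twenty_rmax_le_gap (schedIn κ Φ p O q) ρ,
    Skelφ.Prm.one_le_gap (schedIn κ Φ p O q) ρ, Skelφ.Prm.hsch (schedIn κ Φ p O q) g, Skelφ.Prm.hRt (schedIn κ Φ p O q)⟩

/-- **`44 rmax + 4 ≤ E₀`** and `45 rmax + ψ M ≤ E₀`, `L′ ≤ E₀` (the column rooms of (C)/(R)). [folklore] -/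
theorem E₀_at : 44 * (cells κ Φ p O).rmax + 4 ≤ Skelφ.Prm.E₀ (schedIn κ Φ p O q) ∧
    45 * (cells κ Φ p O).rmax + ψMz O ≤ Skelφ.Prm.E₀ (schedIn κ Φ p O q) ∧
    Skelφ.Prm.Lp (schedIn κ Φ p O q) ≤ Skelφ.Prm.E₀ (schedIn κ Φ p O q) :=
  ⟨Skelφ.Prm.fortyfour_le_E₀ (schedIn κ Φ p O q) (le_trans (by norm_num) (r_le_rmax_at hat 0).2), Skelφ.Prm.planar_le_E₀ (schedIn κ Φ p O q),
    Skelφ.Prm.Lp_le_E₀ (schedIn κ Φ p O q)⟩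

end AtQ

end Sgn₂

end PlanarSkeletonSign

end Summit.CriticalPhenomena.PercolationContinuityZ3.Theorems.Transplant

end
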